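import Literature.Geometry.Lorentzian.KerrCylinderParameterCloseness
import Literature.Geometry.Lorentzian.MultiCentreKerrSchild
import Literature.Geometry.Lorentzian.BilinPullbackEstimates
import HarnessLib

/-!
# Route ClusterCompleteness · crux `OmegaLimitMultiKerr` — select-and-rebase, label half:
# `Cᵏ` closeness to boosted Kerr with converging labels is `Cᵏ` closeness to the limit label

Structure lemmas for the crux stmt-FinalStateConjecture-14664
(`ClusterCompleteness.OmegaLimitMultiKerr`), line `Sketch`, lead gen 3. The recur-disjunct
`Recurs k 𝒟` of the crux (`ClusterCompletenessOmegaLimitMultiKerrDefs`) asks `Cᵏ` `ε`-recurrence of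
each hole chart to ONE FIXED label `(Mᵢ, aᵢ)`, while every ω-limit / LaSalle argument produces
closeness to boosted Kerr–Schild fields `boostedKerrBilin Λ c Mₙ aₙ` whose labels `(Mₙ, aₙ)` may
WANDER along the sequence of times. After Bolzano–Weierstrass on the labels the reduction to the
fixed-label form is the estimate of this file: the motion `(Λ, c)` being tied to the chart and held
fixed, the Kerr–Schild family is `Cᵏ`-Lipschitz in its labels `(M, a)` uniformly on compact subsets
of `{r > 0}`, so on such compacts recurrence with converging labels IS recurrence to the limit
label.

* `contDiffAt_boostedKerrBilin₃` — `(M, a, x) ↦ boostedKerrBilin Λ c M a x` is jointly smooth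
  wherever the rest-frame Kerr–Schild radius `r_a(Λ⁻¹(x − c))` is positive
  (`Kerr.contDiffAt_bilin₃` transported by the affine map `poincareInv Λ c` and the fixed
  pre/post-composition with `Λ⁻¹`);
* `isOpen_setOf_radius_poincareInv_pos` — positivity of that radius is an open condition in
  `((M, a), x)`;
* `exists_norm_iteratedFDeriv_boostedKerrBilin_sub_le` — LIPSCHITZ IN THE LABELS: on `Lab × K`
  (`Lab ⊆ ℝ²` convex compact, `K ⊆ E4` compact, radius positive on `Lab × K`) all `x`-derivatives of
  order `≤ k` satisfy `‖Dⁱ g_{p'}(x) − Dⁱ g_{p}(x)‖ ≤ C ‖p' − p‖` (the tree's parametric mean value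
  inequality `Literature.Analysis.Calculus.exists_norm_iteratedFDeriv_sub_le_parametric`);
* `exists_eventually_supCkENorm_sub_boostedKerrBilin_le` — hence, for labels `pₙ → p₀` and fields
  `Gₙ` of class `Cᵏ` near `K`, eventually
  `‖Gₙ − g_{p₀}‖_{Cᵏ(K)} ≤ ‖Gₙ − g_{pₙ}‖_{Cᵏ(K)} + C ‖pₙ − p₀‖`;
* `tendsto_supCkENorm_sub_boostedKerrBilin_of_tendsto_labels` (the registered stub, closed form) —
  `‖Gₙ − g_{pₙ}‖_{Cᵏ(K)} → 0` and `pₙ → p₀` imply `‖Gₙ − g_{p₀}‖_{Cᵏ(K)} → 0`;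
* `frequently_supCkENorm_sub_boostedKerrBilin_le_of_tendsto_labels` — the same in the `∃ᶠ`-form of
  the crux's recurrence clause.

Everything is proved; Mathlib + `Literature` only. (Elaboration note: applications whose expected
type contains `Kerr.radius`, `Kerr.bilin` or `boostedKerrBilin` of projections of a metavariable are
built with `have h := …` first and matched afterwards, lest the unifier unfold the Kerr–Schild
square roots.)
-/

-- every `Summit.FinalStateConjecture.FinalStateConjecture.…` name repeats the summit = sub-problem segment (D-0017 layout)
set_option linter.dupNamespace false

noncomputable section

open scoped Manifold ContDiff Topology ENNReal
open Set Filter TopologicalSpace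

namespace Summit.FinalStateConjecture.FinalStateConjecture.Theorems.ClusterCompleteness

open Literature.Geometry.Lorentzian

/-! ### Joint smoothness of the boosted Kerr–Schild family in `(M, a, x)` -/

/-- **The boosted Kerr–Schild family `(M, a, x) ↦ boostedKerrBilin Λ c M a x` is jointly `C^n`
wherever the rest-frame radius `r_a(Λ⁻¹(x − c))` is positive**: `Kerr.contDiffAt_bilin₃` composed
with the affine map `(M, a, x) ↦ (M, a, Λ⁻¹(x − c))` and the fixed continuous linear pre- and
post-composition with `Λ⁻¹` (`ContDiffAt.clm_comp`). Kerr–Schild 1965, §3 (Lorentz covariance of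
the ansatz). [cite: KerrSchild1965, §3] -/
theorem contDiffAt_boostedKerrBilin₃ (Λ : lorentzGroup) (c : E4) {q : ℝ × ℝ × E4}
    (hq : 0 < Kerr.radius q.2.1 (poincareInv Λ c q.2.2)) {n : WithTop ℕ∞} :
    ContDiffAt ℝ n (fun q : ℝ × ℝ × E4 ↦ boostedKerrBilin Λ c q.1 q.2.1 q.2.2) q := by
  have hf : ContDiffAt ℝ n (fun q : ℝ × ℝ × E4 ↦ (q.1, q.2.1, poincareInv Λ c q.2.2)) q :=
    contDiffAt_fst.prodMk (contDiffAt_snd.fst.prodMk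
      ((contDiff_poincareInv Λ c).contDiffAt.comp q contDiffAt_snd.snd))
  have hg := Kerr.contDiffAt_bilin₃ (n := n) (q := (q.1, q.2.1, poincareInv Λ c q.2.2)) hq
  have h := hg.comp q hf
  have hK : ContDiffAt ℝ n
      (fun q : ℝ × ℝ × E4 ↦ Kerr.bilin q.1 q.2.1 (poincareInv Λ c q.2.2)) q := h
  exact contDiffAt_const.clm_comp (hK.clm_comp contDiffAt_const)

/-- The Kerr–Schild radius `r_a(x)` is jointly continuous in `(a, x)` on all of `ℝ × E4`
(polynomials and square roots; Visser arXiv:0706.0622, (35)). [cite: arXiv07060622, (35)] -/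
private theorem continuous_radius_uncurry : Continuous fun q : ℝ × E4 ↦ Kerr.radius q.1 q.2 := by
  unfold Kerr.radius E4.spatialNorm
  fun_prop

/-- **Positivity of the rest-frame radius is an open condition in `((M, a), x)`**: the set
`{((M, a), x) | 0 < r_a(Λ⁻¹(x − c))}` is open in `(ℝ × ℝ) × E4` (joint continuity of the
Kerr–Schild radius and continuity of the inverse Poincaré map). [folklore] -/
theorem isOpen_setOf_radius_poincareInv_pos (Λ : lorentzGroup) (c : E4) :
    IsOpen {q : (ℝ × ℝ) × E4 | 0 < Kerr.radius q.1.2 (poincareInv Λ c q.2)} := by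
  have hg : Continuous fun q : (ℝ × ℝ) × E4 ↦ (q.1.2, poincareInv Λ c q.2) :=
    continuous_fst.snd.prodMk ((continuous_poincareInv Λ c).comp continuous_snd)
  have h := continuous_radius_uncurry.comp hg
  exact isOpen_lt continuous_const h

/-! ### Lipschitz dependence on the labels -/

/-- **The boosted Kerr–Schild family is `Cᵏ`-Lipschitz in its labels on compacts of `{r > 0}`.**
For a convex compact label set `Lab ⊆ ℝ × ℝ` and a compact `K ⊆ E4` with
`r_a(Λ⁻¹(x − c)) > 0` for all `(M, a) ∈ Lab`, `x ∈ K`, there is `C ≥ 0` with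
`‖Dⁱ[boostedKerrBilin Λ c M' a'](x) − Dⁱ[boostedKerrBilin Λ c M a](x)‖ ≤ C ‖(M', a') − (M, a)‖`
for all `i ≤ k`, `(M, a), (M', a') ∈ Lab`, `x ∈ K` (joint smoothness and the mean value inequality
in the parameters, `Literature.Analysis.Calculus.exists_norm_iteratedFDeriv_sub_le_parametric`;
Dieudonné 1960, (8.5.4), (8.12.6)). [folklore] -/
theorem exists_norm_iteratedFDeriv_boostedKerrBilin_sub_le (Λ : lorentzGroup) (c : E4)
    {Lab : Set (ℝ × ℝ)} (hLab : IsCompact Lab) (hLabc : Convex ℝ Lab) {K : Set E4}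
    (hK : IsCompact K) (hpos : ∀ p ∈ Lab, ∀ x ∈ K, 0 < Kerr.radius p.2 (poincareInv Λ c x))
    (k : ℕ) :
    ∃ C : ℝ, 0 ≤ C ∧ ∀ i ≤ k, ∀ p ∈ Lab, ∀ p' ∈ Lab, ∀ x ∈ K,
      ‖iteratedFDeriv ℝ i (boostedKerrBilin Λ c p'.1 p'.2) x -
        iteratedFDeriv ℝ i (boostedKerrBilin Λ c p.1 p.2) x‖ ≤ C * ‖p' - p‖ := by
  have hF : ∀ q ∈ {q : (ℝ × ℝ) × E4 | 0 < Kerr.radius q.1.2 (poincareInv Λ c q.2)},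
      ContDiffAt ℝ ∞ (fun q : (ℝ × ℝ) × E4 ↦ boostedKerrBilin Λ c q.1.1 q.1.2 q.2) q := by
    intro q hq
    have hs : ContDiffAt ℝ ∞ (fun q : (ℝ × ℝ) × E4 ↦ (q.1.1, q.1.2, q.2)) q :=
      contDiffAt_fst.fst.prodMk (contDiffAt_fst.snd.prodMk contDiffAt_snd)
    have hg := contDiffAt_boostedKerrBilin₃ Λ c (n := ∞) (q := (q.1.1, q.1.2, q.2)) hq
    have h := hg.comp q hs
    exact h
  exact Literature.Analysis.Calculus.exists_norm_iteratedFDeriv_sub_le_parametric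
    (isOpen_setOf_radius_poincareInv_pos Λ c) hF hLab hLabc hK
    (fun q hq ↦ hpos q.1 hq.1 q.2 hq.2) k

/-! ### Rebasing `Cᵏ` closeness to the limit label -/

/-- **Eventual comparison.** Let `K ⊆ E4` be compact with `r_{a₀}(Λ⁻¹(x − c)) > 0` on `K`, let the
labels `pₙ = (Mₙ, aₙ)` converge to `p₀ = (M₀, a₀)`, and let `Gₙ` be fields of bilinear forms of
class `Cᵏ` on an open `O ⊇ K`. Then there is `C ≥ 0` such that for all large `n`
`‖Gₙ − g_{p₀}‖_{Cᵏ(K)} ≤ ‖Gₙ − g_{pₙ}‖_{Cᵏ(K)} + C ‖pₙ − p₀‖`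
(`g_p = boostedKerrBilin Λ c p.1 p.2`):
positivity of the radius is open in `((M, a), x)`, so by the tube lemma a closed ball of labels
around `p₀` times `K` stays in `{r > 0}`; there the family is `Cᵏ`-Lipschitz in the labels
(`exists_norm_iteratedFDeriv_boostedKerrBilin_sub_le`), and `pₙ` is eventually in the ball.
[folklore] -/
theorem exists_eventually_supCkENorm_sub_boostedKerrBilin_le (Λ : lorentzGroup) (c : E4)
    {K : Set E4} (hK : IsCompact K) {p₀ : ℝ × ℝ}
    (hp₀ : ∀ x ∈ K, 0 < Kerr.radius p₀.2 (poincareInv Λ c x)) {k : ℕ} {O : Set E4}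
    (hO : IsOpen O) (hKO : K ⊆ O) {G : ℕ → E4 → E4 →L[ℝ] E4 →L[ℝ] ℝ}
    (hG : ∀ n, ContDiffOn ℝ k (G n) O) {p : ℕ → ℝ × ℝ} (hp : Tendsto p atTop (𝓝 p₀)) :
    ∃ C : ℝ, 0 ≤ C ∧ ∀ᶠ n in atTop,
      supCkENorm K k (fun x ↦ G n x - boostedKerrBilin Λ c p₀.1 p₀.2 x) ≤
        supCkENorm K k (fun x ↦ G n x - boostedKerrBilin Λ c (p n).1 (p n).2 x) +
          ENNReal.ofReal (C * ‖p n - p₀‖) := by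
  -- a closed ball of labels around `p₀` over which the radius stays positive on `K`
  obtain ⟨u, v, hu, -, hp₀u, hKv, huv⟩ := generalized_tube_lemma isCompact_singleton hK
    (isOpen_setOf_radius_poincareInv_pos Λ c) (fun q hq ↦ by
      obtain ⟨h1, h2⟩ := hq
      rw [mem_singleton_iff] at h1
      show 0 < Kerr.radius q.1.2 (poincareInv Λ c q.2)
      rw [h1]
      exact hp₀ q.2 h2)
  obtain ⟨δ, hδ, hball⟩ := Metric.isOpen_iff.1 hu p₀ (hp₀u (mem_singleton p₀))
  have hLabu : Metric.closedBall p₀ (δ / 2) ⊆ u :=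
    (Metric.closedBall_subset_ball (half_lt_self hδ)).trans hball
  have hpos : ∀ q ∈ Metric.closedBall p₀ (δ / 2), ∀ x ∈ K,
      0 < Kerr.radius q.2 (poincareInv Λ c x) := fun q hq x hx ↦ by
    have h := huv (mk_mem_prod (hLabu hq) (hKv hx))
    exact h
  obtain ⟨C, hC0, hC⟩ := exists_norm_iteratedFDeriv_boostedKerrBilin_sub_le Λ c
    (isCompact_closedBall p₀ (δ / 2)) (convex_closedBall p₀ (δ / 2)) hK hpos k
  have hp₀L : p₀ ∈ Metric.closedBall p₀ (δ / 2) := Metric.mem_closedBall_self (half_pos hδ).le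
  refine ⟨C, hC0, ?_⟩
  filter_upwards [hp (Metric.closedBall_mem_nhds p₀ (half_pos hδ))] with n hn
  refine supCkENorm_le_of_forall_le fun m hm x hx ↦ ?_
  -- `Dᵐ(Gₙ − g_{p₀}) = Dᵐ(Gₙ − g_{pₙ}) + (Dᵐ g_{pₙ} − Dᵐ g_{p₀})` at `x` (all three `Cᵐ` at `x`)
  have hm' : (m : WithTop ℕ∞) ≤ k := by exact_mod_cast hm
  have hGx : ContDiffAt ℝ m (G n) x := ((hG n).contDiffAt (hO.mem_nhds (hKO hx))).of_le hm'
  have hBn : ContDiffAt ℝ m (boostedKerrBilin Λ c (p n).1 (p n).2) x :=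
    contDiffAt_boostedKerrBilin Λ c _ _ (hpos (p n) hn x hx)
  have hB₀ : ContDiffAt ℝ m (boostedKerrBilin Λ c p₀.1 p₀.2) x :=
    contDiffAt_boostedKerrBilin Λ c _ _ (hp₀ x hx)
  have e₀ : iteratedFDeriv ℝ m (fun x ↦ G n x - boostedKerrBilin Λ c p₀.1 p₀.2 x) x =
      iteratedFDeriv ℝ m (G n) x - iteratedFDeriv ℝ m (boostedKerrBilin Λ c p₀.1 p₀.2) x :=
    fun_iteratedFDeriv_sub_apply hGx hB₀
  have eₙ : iteratedFDeriv ℝ m (fun x ↦ G n x - boostedKerrBilin Λ c (p n).1 (p n).2 x) x =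
      iteratedFDeriv ℝ m (G n) x - iteratedFDeriv ℝ m (boostedKerrBilin Λ c (p n).1 (p n).2) x :=
    fun_iteratedFDeriv_sub_apply hGx hBn
  calc ‖iteratedFDeriv ℝ m (fun x ↦ G n x - boostedKerrBilin Λ c p₀.1 p₀.2 x) x‖ₑ
      = ‖(iteratedFDeriv ℝ m (G n) x - iteratedFDeriv ℝ m (boostedKerrBilin Λ c (p n).1 (p n).2) x)
          + (iteratedFDeriv ℝ m (boostedKerrBilin Λ c (p n).1 (p n).2) x -
            iteratedFDeriv ℝ m (boostedKerrBilin Λ c p₀.1 p₀.2) x)‖ₑ := by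
        rw [e₀, sub_add_sub_cancel]
    _ ≤ ‖iteratedFDeriv ℝ m (G n) x - iteratedFDeriv ℝ m (boostedKerrBilin Λ c (p n).1 (p n).2) x‖ₑ
          + ‖iteratedFDeriv ℝ m (boostedKerrBilin Λ c (p n).1 (p n).2) x -
            iteratedFDeriv ℝ m (boostedKerrBilin Λ c p₀.1 p₀.2) x‖ₑ := enorm_add_le _ _
    _ ≤ supCkENorm K k (fun x ↦ G n x - boostedKerrBilin Λ c (p n).1 (p n).2 x) +
          ENNReal.ofReal (C * ‖p n - p₀‖) := by
        refine add_le_add ?_ ?_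
        · rw [← eₙ]
          exact enorm_iteratedFDeriv_le_supCkENorm hm hx _
        · rw [← ofReal_norm]
          exact ENNReal.ofReal_le_ofReal (hC m hm p₀ hp₀L (p n) hn x hx)

/-- **Select-and-rebase, label half: `Cᵏ` closeness on a compact set to boosted Kerr with
converging labels is `Cᵏ` closeness to the limit label.** For a compact `K ⊆ E4` on which the
rest-frame radius of the limit label `p₀ = (M₀, a₀)` is positive, fields `Gₙ` of class `Cᵏ` on an
open `O ⊇ K`, and labels `pₙ = (Mₙ, aₙ) → p₀`: if
`‖Gₙ − boostedKerrBilin Λ c Mₙ aₙ‖_{Cᵏ(K)} → 0` then `‖Gₙ − boostedKerrBilin Λ c M₀ a₀‖_{Cᵏ(K)} → 0`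
(the boosted Kerr–Schild family is `Cᵏ`-Lipschitz in `(M, a)` on compacts of `{r > 0}`,
`exists_eventually_supCkENorm_sub_boostedKerrBilin_le`, and `C ‖pₙ − p₀‖ → 0`). Stated in closed
form (registered structure stub of the crux stmt-FinalStateConjecture-14664). [folklore] -/
theorem tendsto_supCkENorm_sub_boostedKerrBilin_of_tendsto_labels :
    ∀ (Λ : lorentzGroup) (c : E4) {K : Set E4}, IsCompact K → ∀ {p₀ : ℝ × ℝ},
      (∀ x ∈ K, 0 < Kerr.radius p₀.2 (poincareInv Λ c x)) → ∀ {k : ℕ} {O : Set E4}, IsOpen O →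
      K ⊆ O → ∀ {G : ℕ → E4 → E4 →L[ℝ] E4 →L[ℝ] ℝ}, (∀ n, ContDiffOn ℝ k (G n) O) →
      ∀ {p : ℕ → ℝ × ℝ}, Tendsto p atTop (𝓝 p₀) →
      Tendsto (fun n ↦ supCkENorm K k (fun x ↦ G n x - boostedKerrBilin Λ c (p n).1 (p n).2 x))
        atTop (𝓝 0) →
      Tendsto (fun n ↦ supCkENorm K k (fun x ↦ G n x - boostedKerrBilin Λ c p₀.1 p₀.2 x))
        atTop (𝓝 0) := by
  intro Λ c K hK p₀ hp₀ k O hO hKO G hG p hp hT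
  obtain ⟨C, -, hbound⟩ :=
    exists_eventually_supCkENorm_sub_boostedKerrBilin_le Λ c hK hp₀ hO hKO hG hp
  have hpn : Tendsto (fun n ↦ ENNReal.ofReal (C * ‖p n - p₀‖)) atTop (𝓝 0) := by
    have h := (tendsto_iff_norm_sub_tendsto_zero.1 hp).const_mul C
    rw [mul_zero] at h
    simpa only [ENNReal.ofReal_zero] using ENNReal.tendsto_ofReal h
  have hsum := hT.add hpn
  rw [add_zero] at hsum
  exact tendsto_of_tendsto_of_tendsto_of_le_of_le' tendsto_const_nhds hsum
    (Eventually.of_forall fun _ ↦ zero_le) hbound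

/-- **The `∃ᶠ`-form** (the shape of the crux's recurrence clause): under the same hypotheses, if
for every `ε > 0` frequently `‖Gₙ − boostedKerrBilin Λ c Mₙ aₙ‖_{Cᵏ(K)} ≤ ε`, then for every
`ε > 0` frequently `‖Gₙ − boostedKerrBilin Λ c M₀ a₀‖_{Cᵏ(K)} ≤ ε` (extract a subsequence along
which the former tends to `0`, `Filter.extraction_forall_of_frequently`, and rebase it with
`tendsto_supCkENorm_sub_boostedKerrBilin_of_tendsto_labels`). [folklore] -/
theorem frequently_supCkENorm_sub_boostedKerrBilin_le_of_tendsto_labels (Λ : lorentzGroup)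
    (c : E4) {K : Set E4} (hK : IsCompact K) {p₀ : ℝ × ℝ}
    (hp₀ : ∀ x ∈ K, 0 < Kerr.radius p₀.2 (poincareInv Λ c x)) {k : ℕ} {O : Set E4}
    (hO : IsOpen O) (hKO : K ⊆ O) {G : ℕ → E4 → E4 →L[ℝ] E4 →L[ℝ] ℝ}
    (hG : ∀ n, ContDiffOn ℝ k (G n) O) {p : ℕ → ℝ × ℝ} (hp : Tendsto p atTop (𝓝 p₀))
    (hfr : ∀ ε : ℝ, 0 < ε → ∃ᶠ n in atTop,
      supCkENorm K k (fun x ↦ G n x - boostedKerrBilin Λ c (p n).1 (p n).2 x) ≤ ENNReal.ofReal ε)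
    {ε : ℝ} (hε : 0 < ε) :
    ∃ᶠ n in atTop,
      supCkENorm K k (fun x ↦ G n x - boostedKerrBilin Λ c p₀.1 p₀.2 x) ≤ ENNReal.ofReal ε := by
  -- a subsequence along which the deviation from the wandering labels tends to `0`
  obtain ⟨φ, hφ, hφle⟩ := extraction_forall_of_frequently fun m : ℕ ↦
    hfr (1 / ((m : ℝ) + 1)) Nat.one_div_pos_of_nat
  have hT : Tendsto (fun m ↦ supCkENorm K k
      (fun x ↦ G (φ m) x - boostedKerrBilin Λ c (p (φ m)).1 (p (φ m)).2 x)) atTop (𝓝 0) := by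
    have h0 : Tendsto (fun m : ℕ ↦ ENNReal.ofReal (1 / ((m : ℝ) + 1))) atTop (𝓝 0) := by
      simpa only [ENNReal.ofReal_zero] using
        ENNReal.tendsto_ofReal tendsto_one_div_add_atTop_nhds_zero_nat
    exact tendsto_of_tendsto_of_tendsto_of_le_of_le' tendsto_const_nhds h0
      (Eventually.of_forall fun _ ↦ zero_le) (Eventually.of_forall hφle)
  have hlim := tendsto_supCkENorm_sub_boostedKerrBilin_of_tendsto_labels Λ c hK hp₀ hO hKO
    (G := fun m ↦ G (φ m)) (fun m ↦ hG (φ m)) (hp.comp hφ.tendsto_atTop) hT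
  have hev : ∀ᶠ m in atTop, supCkENorm K k
      (fun x ↦ G (φ m) x - boostedKerrBilin Λ c p₀.1 p₀.2 x) ≤ ENNReal.ofReal ε :=
    hlim (ge_mem_nhds (ENNReal.ofReal_pos.2 hε))
  exact hφ.tendsto_atTop.frequently hev.frequently

end Summit.FinalStateConjecture.FinalStateConjecture.Theorems.ClusterCompleteness

end
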